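import Mathlib
import Summits.Ventures.DiscreteObjects.Mahler.SchwarzPickHigher

/-!
# Multiplication by a Schur function contracts `H²`: a Parseval inequality for Taylor coefficients
(venture `DiscreteObjects`, target L)

Cell `pub-namedobj`, seat `pub-namedobj-mahler` (gen 8). Framing: lottery ticket; floor = certified
bounds/negative ranges.

For a Schur function `F` (holomorphic on the unit disc, `‖F‖ ≤ 1`) and a complex polynomial `p`,
the Taylor coefficients `eₙ` of `p · F` satisfy, for every `N`,

  `Σ_{n<N} ‖eₙ‖² ≤ Σₙ ‖pₙ‖²`        (`hardy_contraction`)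

([McKee–Smyth, *Around the Unit Circle*, Prop. 12.11(a) and its use in §12.2.2 via Parseval's
identity]).  Proof: on the circle `|z| = r < 1` write `pF = E + z^N Θ` with `E` the Taylor
polynomial (`TaylorJet.jet_eq`); by orthogonality of `e^{inθ}` (`integral_exp_int_mul`),
`∫|E|² = 2π Σ ‖eₙ‖² r^{2n}`, the cross term `∫ conj(E) z^N Θ` vanishes by Cauchy's theorem
(`integral_exp_mul_eq_zero`), and `∫ |pF|² ≤ ∫ |p|² = 2π Σ ‖pₙ‖² r^{2n}`; finally `r → 1`.
-/

namespace Summit.Ventures.DiscreteObjects.Mahler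

open Polynomial Metric Set Filter Topology Finset MeasureTheory intervalIntegral Complex
open scoped ComplexConjugate Real Interval

noncomputable section

/-! ### Orthogonality on the circle -/

/-- `∫₀^{2π} e^{i m θ} dθ = 2π` if `m = 0` and `0` otherwise (`m ∈ ℤ`). -/
theorem integral_exp_int_mul (m : ℤ) :
    ∫ θ in (0 : ℝ)..2 * π, cexp (m * θ * I) = if m = 0 then (2 * π : ℂ) else 0 := by
  split_ifs with hm
  · subst hm; simp
  · have hc : (m : ℂ) * I ≠ 0 := mul_ne_zero (by exact_mod_cast hm) I_ne_zero
    have h := integral_exp_mul_complex (a := 0) (b := 2 * π) hc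
    have e : ∀ θ : ℝ, cexp (m * θ * I) = cexp ((m : ℂ) * I * θ) := fun θ => by ring_nf
    simp_rw [e]
    rw [h]
    have h1 : cexp ((m : ℂ) * I * (2 * π : ℝ)) = 1 := by
      have := Complex.exp_int_mul_two_pi_mul_I m
      rw [← this]; congr 1; push_cast; ring
    rw [h1]; simp

/-- The point `r e^{iθ}` of the circle of radius `r`. -/
def circPt (r θ : ℝ) : ℂ := r * cexp (θ * I)

/-- `circPt r θ = circleMap 0 r θ`. -/
theorem circPt_eq_circleMap (r θ : ℝ) : circPt r θ = circleMap 0 r θ := by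
  rw [circleMap_zero]; rfl

/-- Continuity of `θ ↦ r e^{iθ}`. -/
theorem continuous_circPt (r : ℝ) : Continuous (circPt r) := by
  unfold circPt; fun_prop

/-- `‖r e^{iθ}‖ = |r|`. -/
theorem norm_circPt (r θ : ℝ) : ‖circPt r θ‖ = |r| := by
  rw [circPt, norm_mul, Complex.norm_real, Real.norm_eq_abs, Complex.norm_exp_ofReal_mul_I, mul_one]

/-- For `0 ≤ r < 1` the circle of radius `r` lies in the unit disc. -/
theorem circPt_mem_ball {r : ℝ} (hr0 : 0 ≤ r) (hr1 : r < 1) (θ : ℝ) : circPt r θ ∈ ball (0 : ℂ) 1 := by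
  rw [mem_ball_zero_iff, norm_circPt, abs_of_nonneg hr0]; exact hr1

/-- Powers on the circle: `(r e^{iθ})ⁿ = rⁿ e^{inθ}`. -/
theorem circPt_pow (r θ : ℝ) (n : ℕ) : circPt r θ ^ n = (r : ℂ) ^ n * cexp (n * θ * I) := by
  rw [circPt, mul_pow, ← Complex.exp_nat_mul]; ring_nf

/-- `(r e^{iθ})ⁿ · conj((r e^{iθ})ᵐ) = r^{n+m} e^{i(n-m)θ}`. -/
theorem circPt_pow_mul_conj_pow (r θ : ℝ) (n m : ℕ) :
    circPt r θ ^ n * conj (circPt r θ ^ m) = (r : ℂ) ^ (n + m) * cexp (((n : ℤ) - m : ℤ) * θ * I) := by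
  rw [circPt_pow, circPt_pow, map_mul, map_pow, Complex.conj_ofReal, ← Complex.exp_conj]
  have : conj ((m : ℂ) * θ * I) = -(m * θ * I) := by
    rw [map_mul, map_mul, Complex.conj_I, Complex.conj_ofReal, map_natCast]; ring
  rw [this, pow_add]
  have e : cexp ((n : ℂ) * θ * I) * cexp (-((m : ℂ) * θ * I)) = cexp ((((n : ℤ) - m : ℤ) : ℂ) * θ * I) := by
    rw [← Complex.exp_add]; congr 1; push_cast; ring
  calc (r : ℂ) ^ n * cexp (n * θ * I) * ((r : ℂ) ^ m * cexp (-(m * θ * I)))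
      = (r : ℂ) ^ n * (r : ℂ) ^ m * (cexp (n * θ * I) * cexp (-(m * θ * I))) := by ring
    _ = (r : ℂ) ^ n * (r : ℂ) ^ m * cexp ((((n : ℤ) - m : ℤ) : ℂ) * θ * I) := by rw [e]

/-- **Orthogonality**: `∫₀^{2π} |Σ_{n<D} qₙ (re^{iθ})ⁿ|² dθ = 2π Σ_{n<D} ‖qₙ‖² r^{2n}` (complex form). -/
theorem integral_conj_mul_sum (q : ℕ → ℂ) (D : ℕ) (r : ℝ) :
    ∫ θ in (0 : ℝ)..2 * π, conj (∑ n ∈ range D, q n * circPt r θ ^ n) *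
        (∑ n ∈ range D, q n * circPt r θ ^ n) =
      (2 * π : ℂ) * ∑ n ∈ range D, (‖q n‖ ^ 2 : ℝ) * r ^ (2 * n) := by
  -- expand the product into a double sum of monomials
  have hexp : ∀ θ : ℝ, conj (∑ n ∈ range D, q n * circPt r θ ^ n) * (∑ n ∈ range D, q n * circPt r θ ^ n)
      = ∑ n ∈ range D, ∑ m ∈ range D,
          (q m * conj (q n) * (r : ℂ) ^ (m + n)) * cexp (((m : ℤ) - n : ℤ) * θ * I) := by
    intro θ
    rw [map_sum, Finset.sum_mul]
    apply Finset.sum_congr rfl; intro n _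
    rw [Finset.mul_sum]
    apply Finset.sum_congr rfl; intro m _
    rw [map_mul]
    have h := circPt_pow_mul_conj_pow r θ m n
    linear_combination (q m * conj (q n)) * h
  simp_rw [hexp]
  have hint : ∀ n m : ℕ, IntervalIntegrable
      (fun θ : ℝ => (q m * conj (q n) * (r : ℂ) ^ (m + n)) * cexp (((m : ℤ) - n : ℤ) * θ * I))
      volume 0 (2 * π) := by
    intro n m; apply Continuous.intervalIntegrable; fun_prop
  rw [intervalIntegral.integral_finsetSum (fun n _ => Continuous.intervalIntegrable (by fun_prop) _ _)]
  rw [Complex.ofReal_sum, Finset.mul_sum]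
  apply Finset.sum_congr rfl; intro n hn
  rw [intervalIntegral.integral_finsetSum (fun m _ => hint n m)]
  simp_rw [intervalIntegral.integral_const_mul, integral_exp_int_mul]
  rw [Finset.sum_eq_single_of_mem n hn]
  · rw [if_pos (by simp), Complex.mul_conj']; push_cast; ring
  · intro m _ hmn
    rw [if_neg (by omega), mul_zero]

/-- **Orthogonality** (real form): `∫₀^{2π} ‖Σ_{n<D} qₙ (re^{iθ})ⁿ‖² dθ = 2π Σ_{n<D} ‖qₙ‖² r^{2n}`. -/
theorem integral_norm_sq_sum (q : ℕ → ℂ) (D : ℕ) (r : ℝ) :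
    ∫ θ in (0 : ℝ)..2 * π, ‖∑ n ∈ range D, q n * circPt r θ ^ n‖ ^ 2 =
      2 * π * ∑ n ∈ range D, ‖q n‖ ^ 2 * r ^ (2 * n) := by
  have h := integral_conj_mul_sum q D r
  simp_rw [Complex.conj_mul', ← Complex.ofReal_pow] at h
  rw [intervalIntegral.integral_ofReal] at h
  exact_mod_cast h

/-! ### The cross term vanishes (Cauchy) -/

/-- For `Θ` holomorphic on the unit disc, `0 < r < 1` and `j ≥ 1`:
`∫₀^{2π} e^{ijθ} Θ(re^{iθ}) dθ = 0`. -/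
theorem integral_exp_mul_eq_zero {Θ : ℂ → ℂ} (hΘ : DifferentiableOn ℂ Θ (ball 0 1)) {r : ℝ}
    (hr0 : 0 < r) (hr1 : r < 1) {j : ℕ} (hj : 1 ≤ j) :
    ∫ θ in (0 : ℝ)..2 * π, cexp (j * θ * I) * Θ (circPt r θ) = 0 := by
  -- Cauchy's theorem for `z ↦ z^(j-1) Θ z` on the closed disc of radius `r`
  have hsub : closedBall (0 : ℂ) r ⊆ ball 0 1 := closedBall_subset_ball hr1
  set g : ℂ → ℂ := fun z => z ^ (j - 1) * Θ z with hg
  have hgc : ContinuousOn g (closedBall 0 r) :=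
    ((continuousOn_id.pow _).mul (hΘ.continuousOn.mono hsub))
  have hgd : ∀ z ∈ ball (0 : ℂ) r \ ∅, DifferentiableAt ℂ g z := by
    intro z hz
    have hz' : z ∈ ball (0 : ℂ) 1 := ball_subset_ball hr1.le hz.1
    exact ((differentiableAt_id.pow _).mul (hΘ.differentiableAt (isOpen_ball.mem_nhds hz')))
  have hC := Complex.circleIntegral_eq_zero_of_differentiable_on_off_countable hr0.le
    Set.countable_empty hgc hgd
  -- unfold the circle integral
  rw [circleIntegral] at hC
  have e : ∀ θ : ℝ, deriv (circleMap 0 r) θ • g (circleMap 0 r θ) =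
      ((r : ℂ) ^ j * I) * (cexp (j * θ * I) * Θ (circPt r θ)) := by
    intro θ
    rw [deriv_circleMap, ← circPt_eq_circleMap, smul_eq_mul, hg]
    simp only
    rw [circPt_pow]
    have hj' : ((j - 1 : ℕ) : ℂ) = (j : ℂ) - 1 := by
      rw [Nat.cast_sub hj]; simp
    rw [hj', circPt]
    have : (r : ℂ) ^ j = (r : ℂ) ^ (j - 1) * r := by
      rw [← pow_succ, Nat.sub_add_cancel hj]
    rw [this]
    have e2 : cexp (θ * I) * cexp (((j : ℂ) - 1) * θ * I) = cexp (j * θ * I) := by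
      rw [← Complex.exp_add]; congr 1; ring
    calc (r : ℂ) * cexp (θ * I) * I * ((r : ℂ) ^ (j - 1) * cexp (((j : ℂ) - 1) * θ * I) *
          Θ (r * cexp (θ * I)))
        = (r : ℂ) ^ (j - 1) * r * I * ((cexp (θ * I) * cexp (((j : ℂ) - 1) * θ * I)) *
          Θ (r * cexp (θ * I))) := by ring
      _ = _ := by rw [e2]
  simp_rw [e] at hC
  rw [intervalIntegral.integral_const_mul] at hC
  have hne : (r : ℂ) ^ j * I ≠ 0 :=
    mul_ne_zero (pow_ne_zero _ (by exact_mod_cast hr0.ne')) I_ne_zero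
  exact (mul_eq_zero.mp hC).resolve_left hne

/-- The cross term: for a polynomial part `E = Σ_{n<N} eₙ zⁿ` and `Θ` holomorphic on the disc,
`∫₀^{2π} conj(E(w)) · w^N Θ(w) dθ = 0` (`w = re^{iθ}`, `0 < r < 1`). -/
theorem integral_cross_eq_zero (e : ℕ → ℂ) (N : ℕ) {Θ : ℂ → ℂ} (hΘ : DifferentiableOn ℂ Θ (ball 0 1))
    {r : ℝ} (hr0 : 0 < r) (hr1 : r < 1) :
    ∫ θ in (0 : ℝ)..2 * π, conj (∑ n ∈ range N, e n * circPt r θ ^ n) *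
      (circPt r θ ^ N * Θ (circPt r θ)) = 0 := by
  have hΘc : Continuous fun θ : ℝ => Θ (circPt r θ) :=
    hΘ.continuousOn.comp_continuous (continuous_circPt r) (fun θ => circPt_mem_ball hr0.le hr1 θ)
  have hexp : ∀ θ : ℝ, conj (∑ n ∈ range N, e n * circPt r θ ^ n) * (circPt r θ ^ N * Θ (circPt r θ))
      = ∑ n ∈ range N, (conj (e n) * (r : ℂ) ^ (N + n)) *
          (cexp (((N - n : ℕ) : ℕ) * θ * I) * Θ (circPt r θ)) := by
    intro θ
    rw [map_sum, Finset.sum_mul]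
    apply Finset.sum_congr rfl; intro n hn
    have hnN : n ≤ N := (Finset.mem_range.mp hn).le
    rw [map_mul]
    have h := circPt_pow_mul_conj_pow r θ N n
    have hcast : (((N : ℤ) - n : ℤ) : ℂ) = (((N - n : ℕ) : ℕ) : ℂ) := by
      rw [Nat.cast_sub hnN]; push_cast; ring
    rw [hcast] at h
    calc conj (e n) * conj (circPt r θ ^ n) * (circPt r θ ^ N * Θ (circPt r θ))
        = conj (e n) * (circPt r θ ^ N * conj (circPt r θ ^ n)) * Θ (circPt r θ) := by ring
      _ = _ := by rw [h]; ring
  simp_rw [hexp]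
  have hint : ∀ n ∈ range N, IntervalIntegrable (fun θ : ℝ => (conj (e n) * (r : ℂ) ^ (N + n)) *
      (cexp (((N - n : ℕ) : ℕ) * θ * I) * Θ (circPt r θ))) volume 0 (2 * π) := by
    intro n _
    apply Continuous.intervalIntegrable
    exact continuous_const.mul ((by fun_prop : Continuous fun θ : ℝ => cexp (((N - n : ℕ) : ℕ) * θ * I)).mul hΘc)
  rw [intervalIntegral.integral_finsetSum hint]
  apply Finset.sum_eq_zero; intro n hn
  rw [intervalIntegral.integral_const_mul,
    integral_exp_mul_eq_zero hΘ hr0 hr1 (j := N - n) (by have := Finset.mem_range.mp hn; omega),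
    mul_zero]

/-! ### The contraction inequality -/

/-- **`H²`-contraction.**  For a Schur function `F` and a polynomial `p`, the Taylor coefficients of
`p · F` satisfy `Σ_{n<N} ‖eₙ‖² ≤ Σ_{n ≤ deg p} ‖pₙ‖²` for every `N`. -/
theorem hardy_contraction {F : ℂ → ℂ} (hF : IsSchur F) (p : ℂ[X]) (N : ℕ) :
    ∑ n ∈ range N, ‖jetCoeff (fun z => p.eval z * F z) n‖ ^ 2 ≤
      ∑ n ∈ range (p.natDegree + 1), ‖p.coeff n‖ ^ 2 := by
  set G : ℂ → ℂ := fun z => p.eval z * F z with hGdef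
  have hGd : DifferentiableOn ℂ G (ball 0 1) := (p.differentiable.differentiableOn).mul hF.differentiableOn
  set e : ℕ → ℂ := fun n => jetCoeff G n with hedef
  set Θ := jetTail G N with hΘdef
  have hΘd : DifferentiableOn ℂ Θ (ball 0 1) := differentiableOn_jetTail one_pos hGd N
  set B : ℝ := ∑ n ∈ range (p.natDegree + 1), ‖p.coeff n‖ ^ 2 with hB
  -- the bound on each circle of radius `r < 1`
  have hcirc : ∀ r : ℝ, 0 < r → r < 1 → ∑ n ∈ range N, ‖e n‖ ^ 2 * r ^ (2 * n) ≤ B := by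
    intro r hr0 hr1
    have hmem : ∀ θ : ℝ, circPt r θ ∈ ball (0 : ℂ) 1 := circPt_mem_ball hr0.le hr1
    -- continuity of the players on the circle
    have hFc : Continuous fun θ : ℝ => F (circPt r θ) :=
      hF.differentiableOn.continuousOn.comp_continuous (continuous_circPt r) hmem
    have hΘc : Continuous fun θ : ℝ => Θ (circPt r θ) :=
      hΘd.continuousOn.comp_continuous (continuous_circPt r) hmem
    have hEc : Continuous fun θ : ℝ => ∑ n ∈ range N, e n * circPt r θ ^ n := by
      have := continuous_circPt r; fun_prop
    have hpc : Continuous fun θ : ℝ => p.eval (circPt r θ) :=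
      p.continuous.comp (continuous_circPt r)
    -- pointwise decomposition `G = E + w^N Θ`
    have hdec : ∀ θ : ℝ, G (circPt r θ) =
        (∑ n ∈ range N, e n * circPt r θ ^ n) + circPt r θ ^ N * Θ (circPt r θ) :=
      fun θ => jet_eq G N (circPt r θ)
    -- (1) `∫ ‖E‖² = 2π Σ ‖eₙ‖² r^{2n}`
    have h1 := integral_norm_sq_sum e N r
    -- (2) `∫ ‖E‖² ≤ ∫ ‖G‖²`
    set v : ℝ → ℂ := fun θ => circPt r θ ^ N * Θ (circPt r θ) with hv
    have hvc : Continuous v := ((continuous_circPt r).pow N).mul hΘc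
    have hcross : ∫ θ in (0 : ℝ)..2 * π,
        (conj (∑ n ∈ range N, e n * circPt r θ ^ n) * v θ).re = 0 := by
      have hint : IntervalIntegrable (fun θ : ℝ => conj (∑ n ∈ range N, e n * circPt r θ ^ n) * v θ)
          volume 0 (2 * π) :=
        (Continuous.intervalIntegrable (by fun_prop) _ _)
      have h := Complex.reCLM.intervalIntegral_comp_comm hint
      simp only [Complex.reCLM_apply] at h
      rw [h, hv]
      simp only
      rw [integral_cross_eq_zero e N hΘd hr0 hr1, Complex.zero_re]
    have h2 : ∫ θ in (0 : ℝ)..2 * π, ‖∑ n ∈ range N, e n * circPt r θ ^ n‖ ^ 2 ≤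
        ∫ θ in (0 : ℝ)..2 * π, ‖G (circPt r θ)‖ ^ 2 := by
      -- pointwise `‖u + v‖² = ‖u‖² + 2 Re(conj u · v) + ‖v‖²` (as in the tree's
      -- `Literature.Barriers.RiemannHypothesis.BoxCert.norm_add_sq_eq`, inlined here)
      have hnorm : ∀ u w : ℂ, ‖u + w‖ ^ 2 = ‖u‖ ^ 2 + 2 * (conj u * w).re + ‖w‖ ^ 2 := by
        intro u w
        rw [Complex.sq_norm, Complex.sq_norm, Complex.sq_norm, Complex.normSq_add]
        have : (u * conj w).re = (conj u * w).re := by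
          rw [← Complex.conj_re (u * conj w), map_mul, Complex.conj_conj, mul_comm]
        rw [this]; ring
      have hsplit : ∀ θ : ℝ, ‖G (circPt r θ)‖ ^ 2 =
          ‖∑ n ∈ range N, e n * circPt r θ ^ n‖ ^ 2 +
            (2 * (conj (∑ n ∈ range N, e n * circPt r θ ^ n) * v θ).re + ‖v θ‖ ^ 2) := by
        intro θ; rw [hdec θ, hnorm]; ring
      simp_rw [hsplit]
      have hi1 : IntervalIntegrable (fun θ : ℝ => ‖∑ n ∈ range N, e n * circPt r θ ^ n‖ ^ 2)
          volume 0 (2 * π) := Continuous.intervalIntegrable (by fun_prop) _ _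
      have hi2 : IntervalIntegrable
          (fun θ : ℝ => 2 * (conj (∑ n ∈ range N, e n * circPt r θ ^ n) * v θ).re) volume 0 (2 * π) :=
        Continuous.intervalIntegrable (by fun_prop) _ _
      have hi3 : IntervalIntegrable (fun θ : ℝ => ‖v θ‖ ^ 2) volume 0 (2 * π) :=
        Continuous.intervalIntegrable (by fun_prop) _ _
      rw [intervalIntegral.integral_add hi1 (hi2.add hi3), intervalIntegral.integral_add hi2 hi3,
        intervalIntegral.integral_const_mul, hcross, mul_zero, zero_add]
      have : 0 ≤ ∫ θ in (0 : ℝ)..2 * π, ‖v θ‖ ^ 2 :=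
        intervalIntegral.integral_nonneg (by positivity) (fun θ _ => by positivity)
      linarith
    -- (3) `∫ ‖G‖² ≤ ∫ ‖p‖²`
    have h3 : ∫ θ in (0 : ℝ)..2 * π, ‖G (circPt r θ)‖ ^ 2 ≤
        ∫ θ in (0 : ℝ)..2 * π, ‖p.eval (circPt r θ)‖ ^ 2 := by
      apply intervalIntegral.integral_mono_on (by positivity)
      · exact Continuous.intervalIntegrable ((hpc.mul hFc).norm.pow 2) _ _
      · exact Continuous.intervalIntegrable (hpc.norm.pow 2) _ _
      · intro θ _
        rw [hGdef]; simp only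
        rw [norm_mul]
        have hF1 : ‖F (circPt r θ)‖ ≤ 1 := hF.norm_le _ (hmem θ)
        have hp0 : 0 ≤ ‖p.eval (circPt r θ)‖ := norm_nonneg _
        have : ‖p.eval (circPt r θ)‖ * ‖F (circPt r θ)‖ ≤ ‖p.eval (circPt r θ)‖ * 1 := by gcongr
        rw [mul_one] at this
        exact pow_le_pow_left₀ (by positivity) this 2
    -- (4) `∫ ‖p‖² = 2π Σ ‖pₙ‖² r^{2n} ≤ 2π B`
    have h4 : ∫ θ in (0 : ℝ)..2 * π, ‖p.eval (circPt r θ)‖ ^ 2 ≤ 2 * π * B := by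
      have hev : ∀ θ : ℝ, p.eval (circPt r θ) =
          ∑ n ∈ range (p.natDegree + 1), p.coeff n * circPt r θ ^ n :=
        fun θ => eval_eq_sum_range (circPt r θ)
      simp_rw [hev]
      rw [integral_norm_sq_sum (fun n => p.coeff n) (p.natDegree + 1) r, hB]
      gcongr with n _
      have : r ^ (2 * n) ≤ 1 := pow_le_one₀ hr0.le hr1.le
      calc ‖p.coeff n‖ ^ 2 * r ^ (2 * n) ≤ ‖p.coeff n‖ ^ 2 * 1 := by gcongr
        _ = ‖p.coeff n‖ ^ 2 := mul_one _
    have hchain : 2 * π * ∑ n ∈ range N, ‖e n‖ ^ 2 * r ^ (2 * n) ≤ 2 * π * B := by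
      rw [← h1]; linarith
    exact le_of_mul_le_mul_left hchain (by positivity)
  -- let `r → 1`
  have hcont : ContinuousAt (fun r : ℝ => ∑ n ∈ range N, ‖e n‖ ^ 2 * r ^ (2 * n)) 1 := by fun_prop
  have htend : Tendsto (fun r : ℝ => ∑ n ∈ range N, ‖e n‖ ^ 2 * r ^ (2 * n)) (𝓝[<] (1 : ℝ))
      (𝓝 (∑ n ∈ range N, ‖e n‖ ^ 2)) := by
    have := hcont.tendsto.mono_left (nhdsWithin_le_nhds (s := Iio (1 : ℝ)))
    simpa using this
  have hev : ∀ᶠ r in 𝓝[<] (1 : ℝ), ∑ n ∈ range N, ‖e n‖ ^ 2 * r ^ (2 * n) ≤ B := by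
    filter_upwards [Ioo_mem_nhdsLT (show (0 : ℝ) < 1 by norm_num)] with r hr
    exact hcirc r hr.1 hr.2
  exact le_of_tendsto htend hev

end

end Summit.Ventures.DiscreteObjects.Mahler
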